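import Literature.Probability.Percolation.StrongHarrisThreePoint
import Literature.Probability.Percolation.GladkovThreePointBoundWeighted
import HarnessLib

/-!
# The three-point connectivity ratio `P(abc)/√(P(ab)P(ac)P(bc))`: Gladkov's universal upper bound, and the
# product ("clean") forms of the cubic three-petal-sunflower rows

Topic `Literature/Probability/Percolation` (the percolation fact and identity) and
`Literature/Probability/LatticeModels` (abstract identities for any probability measure).  One NAMED FACT
(`Gladkov2024_threePoint_sq_le_eight`, a printed theorem — DISCHARGED at the end of this file by
`Gladkov2024_threePoint_sq_le_eight_holds` from the tree's `gladkov2024_thm_1_1_prodBernoulli`); everything else is PROVED and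
introduces no definition.

## Sources, as printed, and status

* **Gladkov 2024**, *Percolation Inequalities and Decision Trees*: "**Theorem 1.1** (see Theorem 6.2).
  Let `a, b, c` be distinct vertices of graph `G`. Then `P(abc)² ≤ 8 P(ab)P(ac)P(bc)`, (1) where `P(abc)` is
  the probability that `a, b` and `c` are in the same percolation cluster. … This inequality can be seen
  as the `√8` bound on the Delfino–Viti constant for every graph [DV11]. Moreover, when the graph `G` is
  planar and `a, b` and `c` belong to the same face, we bring the constant `8` in (1) down to `2`."
  [cite: Gladkov2024, Thm. 1.1 (arXiv p. 2)]  Setting: Bernoulli bond percolation "where each edge `e ∈ E`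
  is assigned a probability `p_e` of being open" (ibid. p. 1–2); proof by the decision-tree
  Harris–Kleitman and van den Berg–Kesten inequalities (ibid. Thms. 3.2, 4.3, §6).  §6.3 (arXiv p. 10):
  "For the supercritical mode, denote by `θ` the density of the infinite cluster. Then equation (13)
  tends to `θ⁶ ≤ 8θ⁶` as `a, b` and `c` tend away from each other."  PROVED in print; vendored below as a
  named fact for the tree's model `prodBernoulli w` (complete graph on a finite vertex type with arbitrary
  edge weights `w : Sym2 V → [0,1]`, which is the printed setting with `p_e = w e`).
* **Delfino–Viti 2010**: "we will determine exactly the universal quantity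
  `R(x₁,x₂,x₃) = P₃(x₁,x₂,x₃)/√(P₂(x₁,x₂)P₂(x₁,x₃)P₂(x₂,x₃))` at `p_c`" (`≈ 1.022` for two-dimensional
  critical percolation). [cite: DelfinoViti2010, §1 (arXiv p. 1)]  (Context only; nothing of it is used.)
* **Gladkov–Zimin**, §8 "Appendix: optimizing `α₃`": "if `P(abc) = P(a|b|c)`, it seems this probability
  can only lie in a narrow range from `0.27` to `0.291`. Indeed, in this case inequality (e2) gives the
  lower bound of `2 − √3 ≈ 0.2679`." [cite: GladkovZimin2024, §8 (Appendix)]  ((e2) is the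
  Aas–Gladkov inequality, tree `prodBernoulli_threePoint_strongHarris`.)  Observation only; not used.

## What is proved here (bookkeeping; not stated in the sources)

For three events `U₁, U₂, U₃` of a probability space whose pairwise intersections all equal `A`
("three-petal sunflower", petals `C_i = U_i ∖ A`, outside `B = (U₁ ∪ U₂ ∪ U₃)ᶜ`; `a = μ(A)`, `b = μ(B)`,
`c_i = μ(C_i)`, `e₂ = Σ_{i<j} c_ic_j`, `e₃ = c₁c₂c₃`, so `a + b + c₁ + c₂ + c₃ = 1`):
* `sunflower_core_sq_sub_prod_eq` — `μ(A)² − μ(U₁)μ(U₂)μ(U₃) = a·(a·b − e₂) − e₃`;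
* `sunflower_outside_sq_sub_prod_eq` — `μ(B)² − μ((U₁∪U₂)ᶜ)μ((U₁∪U₃)ᶜ)μ((U₂∪U₃)ᶜ) = b·(a·b − e₂) − e₃`
  (note `(U_i ∪ U_j)ᶜ = B ∪ C_k`);
* `sunflower_core_outside_exchange` — `b·[μ(A)² − Πμ(U_i)] − a·[μ(B)² − Πμ((U_i∪U_j)ᶜ)] = (a − b)·e₃`;
* `le_max_mul_iff_of_nonneg` — for `0 ≤ x`: `e ≤ max a b · x ↔ e ≤ a·x ∨ e ≤ b·x` (so that
  `e₃ ≤ max(a,b)·(ab − e₂)` is the disjunction of the two product inequalities above);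
* the two families on which one of the product forms is an IDENTITY, for three events `E₁, E₂, E₃` that
  are mutually independent (stated as the four product equalities):
  `indep₃_prod_pairInter_eq_sq` — `μ(E₂∩E₃)·μ(E₁∩E₃)·μ(E₁∩E₂) = μ(E₁∩E₂∩E₃)²` (the "star": the events
  `U_i = E_j ∩ E_k` form a sunflower with core `E₁ ∩ E₂ ∩ E₃`, `star_pairInter`), and
  `indep₃_prod_pairUnion_compl_eq_sq` — `μ((E₁∪E₂)ᶜ)·μ((E₁∪E₃)ᶜ)·μ((E₂∪E₃)ᶜ) = μ((E₁∪E₂∪E₃)ᶜ)²` (the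
  "triangle": `U_i = E_i ∪ (E_j ∩ E_k)` is a sunflower with core "at least two of the `E`'s" and
  `U_i ∪ U_j = E_i ∪ E_j`, `triangle_pairInter`, `triangle_pairUnion`);
* `prodBernoulli_threePoint_sq_sub_prod_eq` — for bond percolation and vertices `a, b, c`, with the cells
  `t = μ(abc)`, `q = μ(a|b|c)`, `u₃ = μ(ab|c)`, `u₂ = μ(ac|b)`, `u₁ = μ(a|bc)` of
  `SahiThreePointSeparation.lean`:  `μ(abc)² − μ(ab)μ(ac)μ(bc) = t·(q·t − e₂(u)) − e₃(u)`.  Hence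
  `R(a,b,c) ≥ 1 ⟺ μ(ab)μ(ac)μ(bc) ≤ μ(abc)² ⟺ e₃(u) ≤ t·(q·t − e₂(u))`, the cubic companion of the
  Aas–Gladkov inequality `q·t ≥ e₂(u)`; Harris alone gives `μ(ab)μ(ac)μ(bc) ≤ μ(abc)^{3/2}`.
  (Whether `R ≥ 1` holds whenever `μ(ab) + μ(ac) + μ(bc) ≥ 1 + μ(abc)` is NOT in print and is not
  asserted here; on the two families above the corresponding product form vanishes identically.)
-/

namespace Literature.Probability.LatticeModels

open MeasureTheory

section General

variable {Ω : Type*} [MeasurableSpace Ω] (μ : Measure Ω) [IsProbabilityMeasure μ]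

/-- Elementary: for `0 ≤ x`, `e ≤ max a b · x ↔ (e ≤ a·x ∨ e ≤ b·x)`. [folklore] -/
theorem le_max_mul_iff_of_nonneg {a b x e : ℝ} (hx : 0 ≤ x) :
    e ≤ max a b * x ↔ e ≤ a * x ∨ e ≤ b * x := by
  rw [max_mul_of_nonneg a b hx, le_max_iff]

variable {U₁ U₂ U₃ A : Set Ω}

/-- **Core product form.**  For a probability measure and measurable `U₁, U₂, U₃` with all pairwise
intersections equal to `A`, writing `a = μ(A)`, `b = μ((U₁ ∪ U₂ ∪ U₃)ᶜ)`, `c_i = μ(U_i ∖ A)`: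
`μ(A)² − μ(U₁)μ(U₂)μ(U₃) = a·(a·b − (c₁c₂ + c₁c₃ + c₂c₃)) − c₁c₂c₃`.
(Measure bookkeeping; not stated in the sources.) [folklore] -/
theorem sunflower_core_sq_sub_prod_eq (h₁ : MeasurableSet U₁) (h₂ : MeasurableSet U₂)
    (h₃ : MeasurableSet U₃) (h12 : U₁ ∩ U₂ = A) (h13 : U₁ ∩ U₃ = A) (h23 : U₂ ∩ U₃ = A) :
    μ.real A ^ 2 - μ.real U₁ * μ.real U₂ * μ.real U₃ =
      μ.real A *
          (μ.real A * μ.real (U₁ ∪ U₂ ∪ U₃)ᶜ -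
            (μ.real (U₁ \ A) * μ.real (U₂ \ A) + μ.real (U₁ \ A) * μ.real (U₃ \ A) +
              μ.real (U₂ \ A) * μ.real (U₃ \ A))) -
        μ.real (U₁ \ A) * μ.real (U₂ \ A) * μ.real (U₃ \ A) := by
  have hA : MeasurableSet A := by rw [← h12]; exact h₁.inter h₂
  have hAU₁ : U₁ ∩ A = A := by
    rw [Set.inter_eq_right, ← h12]; exact Set.inter_subset_left
  have hAU₂ : U₂ ∩ A = A := by
    rw [Set.inter_eq_right, ← h12]; exact Set.inter_subset_right
  have hAU₃ : U₃ ∩ A = A := by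
    rw [Set.inter_eq_right, ← h13]; exact Set.inter_subset_right
  have d₁ : μ.real (U₁ \ A) = μ.real U₁ - μ.real A := by
    have h := measureReal_inter_add_sdiff (μ := μ) (s := U₁) hA
    rw [hAU₁] at h
    linarith
  have d₂ : μ.real (U₂ \ A) = μ.real U₂ - μ.real A := by
    have h := measureReal_inter_add_sdiff (μ := μ) (s := U₂) hA
    rw [hAU₂] at h
    linarith
  have d₃ : μ.real (U₃ \ A) = μ.real U₃ - μ.real A := by
    have h := measureReal_inter_add_sdiff (μ := μ) (s := U₃) hA
    rw [hAU₃] at h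
    linarith
  have hU12 : μ.real (U₁ ∪ U₂) = μ.real U₁ + μ.real U₂ - μ.real A := by
    have h := measureReal_union_add_inter (μ := μ) (s := U₁) h₂
    rw [h12] at h
    linarith
  have hU123 : μ.real (U₁ ∪ U₂ ∪ U₃) = μ.real U₁ + μ.real U₂ + μ.real U₃ - 2 * μ.real A := by
    have h := measureReal_union_add_inter (μ := μ) (s := U₁ ∪ U₂) h₃
    rw [Set.union_inter_distrib_right, h13, h23, Set.union_self, hU12] at h
    linarith
  have cB : μ.real (U₁ ∪ U₂ ∪ U₃)ᶜ = 1 - (μ.real U₁ + μ.real U₂ + μ.real U₃ - 2 * μ.real A) := by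
    rw [probReal_compl_eq_one_sub ((h₁.union h₂).union h₃), hU123]
  rw [cB, d₁, d₂, d₃]
  ring

/-- **Outside product form.**  Same setting as `sunflower_core_sq_sub_prod_eq`:
`μ((U₁∪U₂∪U₃)ᶜ)² − μ((U₁∪U₂)ᶜ)μ((U₁∪U₃)ᶜ)μ((U₂∪U₃)ᶜ) = b·(a·b − (c₁c₂ + c₁c₃ + c₂c₃)) − c₁c₂c₃`
(and `(U_i ∪ U_j)ᶜ = (U₁∪U₂∪U₃)ᶜ ∪ (U_k ∖ A)`).  (Measure bookkeeping; not stated in the sources.) [folklore] -/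
theorem sunflower_outside_sq_sub_prod_eq (h₁ : MeasurableSet U₁) (h₂ : MeasurableSet U₂)
    (h₃ : MeasurableSet U₃) (h12 : U₁ ∩ U₂ = A) (h13 : U₁ ∩ U₃ = A) (h23 : U₂ ∩ U₃ = A) :
    μ.real (U₁ ∪ U₂ ∪ U₃)ᶜ ^ 2 -
        μ.real (U₁ ∪ U₂)ᶜ * μ.real (U₁ ∪ U₃)ᶜ * μ.real (U₂ ∪ U₃)ᶜ =
      μ.real (U₁ ∪ U₂ ∪ U₃)ᶜ *
          (μ.real A * μ.real (U₁ ∪ U₂ ∪ U₃)ᶜ -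
            (μ.real (U₁ \ A) * μ.real (U₂ \ A) + μ.real (U₁ \ A) * μ.real (U₃ \ A) +
              μ.real (U₂ \ A) * μ.real (U₃ \ A))) -
        μ.real (U₁ \ A) * μ.real (U₂ \ A) * μ.real (U₃ \ A) := by
  have hA : MeasurableSet A := by rw [← h12]; exact h₁.inter h₂
  have hAU₁ : U₁ ∩ A = A := by
    rw [Set.inter_eq_right, ← h12]; exact Set.inter_subset_left
  have hAU₂ : U₂ ∩ A = A := by
    rw [Set.inter_eq_right, ← h12]; exact Set.inter_subset_right
  have hAU₃ : U₃ ∩ A = A := by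
    rw [Set.inter_eq_right, ← h13]; exact Set.inter_subset_right
  have d₁ : μ.real (U₁ \ A) = μ.real U₁ - μ.real A := by
    have h := measureReal_inter_add_sdiff (μ := μ) (s := U₁) hA
    rw [hAU₁] at h
    linarith
  have d₂ : μ.real (U₂ \ A) = μ.real U₂ - μ.real A := by
    have h := measureReal_inter_add_sdiff (μ := μ) (s := U₂) hA
    rw [hAU₂] at h
    linarith
  have d₃ : μ.real (U₃ \ A) = μ.real U₃ - μ.real A := by
    have h := measureReal_inter_add_sdiff (μ := μ) (s := U₃) hA
    rw [hAU₃] at h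
    linarith
  have hU12 : μ.real (U₁ ∪ U₂) = μ.real U₁ + μ.real U₂ - μ.real A := by
    have h := measureReal_union_add_inter (μ := μ) (s := U₁) h₂
    rw [h12] at h
    linarith
  have hU13 : μ.real (U₁ ∪ U₃) = μ.real U₁ + μ.real U₃ - μ.real A := by
    have h := measureReal_union_add_inter (μ := μ) (s := U₁) h₃
    rw [h13] at h
    linarith
  have hU23 : μ.real (U₂ ∪ U₃) = μ.real U₂ + μ.real U₃ - μ.real A := by
    have h := measureReal_union_add_inter (μ := μ) (s := U₂) h₃
    rw [h23] at h
    linarith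
  have hU123 : μ.real (U₁ ∪ U₂ ∪ U₃) = μ.real U₁ + μ.real U₂ + μ.real U₃ - 2 * μ.real A := by
    have h := measureReal_union_add_inter (μ := μ) (s := U₁ ∪ U₂) h₃
    rw [Set.union_inter_distrib_right, h13, h23, Set.union_self, hU12] at h
    linarith
  have c12 : μ.real (U₁ ∪ U₂)ᶜ = 1 - (μ.real U₁ + μ.real U₂ - μ.real A) := by
    rw [probReal_compl_eq_one_sub (h₁.union h₂), hU12]
  have c13 : μ.real (U₁ ∪ U₃)ᶜ = 1 - (μ.real U₁ + μ.real U₃ - μ.real A) := by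
    rw [probReal_compl_eq_one_sub (h₁.union h₃), hU13]
  have c23 : μ.real (U₂ ∪ U₃)ᶜ = 1 - (μ.real U₂ + μ.real U₃ - μ.real A) := by
    rw [probReal_compl_eq_one_sub (h₂.union h₃), hU23]
  have cB : μ.real (U₁ ∪ U₂ ∪ U₃)ᶜ = 1 - (μ.real U₁ + μ.real U₂ + μ.real U₃ - 2 * μ.real A) := by
    rw [probReal_compl_eq_one_sub ((h₁.union h₂).union h₃), hU123]
  rw [cB, c12, c13, c23, d₁, d₂, d₃]
  ring

/-- **Core/outside exchange identity.**  Same setting: with `a = μ(A)`, `b = μ((U₁∪U₂∪U₃)ᶜ)`,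
`b·[μ(A)² − μ(U₁)μ(U₂)μ(U₃)] − a·[μ((U₁∪U₂∪U₃)ᶜ)² − μ((U₁∪U₂)ᶜ)μ((U₁∪U₃)ᶜ)μ((U₂∪U₃)ᶜ)] = (a − b)·c₁c₂c₃`.
Consequently, when `a ≥ b` the outside product inequality implies the core one and conversely when
`b ≥ a`.  (Not stated in the sources.) [folklore] -/
theorem sunflower_core_outside_exchange (h₁ : MeasurableSet U₁) (h₂ : MeasurableSet U₂)
    (h₃ : MeasurableSet U₃) (h12 : U₁ ∩ U₂ = A) (h13 : U₁ ∩ U₃ = A) (h23 : U₂ ∩ U₃ = A) :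
    μ.real (U₁ ∪ U₂ ∪ U₃)ᶜ * (μ.real A ^ 2 - μ.real U₁ * μ.real U₂ * μ.real U₃) -
        μ.real A *
          (μ.real (U₁ ∪ U₂ ∪ U₃)ᶜ ^ 2 -
            μ.real (U₁ ∪ U₂)ᶜ * μ.real (U₁ ∪ U₃)ᶜ * μ.real (U₂ ∪ U₃)ᶜ) =
      (μ.real A - μ.real (U₁ ∪ U₂ ∪ U₃)ᶜ) *
        (μ.real (U₁ \ A) * μ.real (U₂ \ A) * μ.real (U₃ \ A)) := by
  rw [sunflower_core_sq_sub_prod_eq μ h₁ h₂ h₃ h12 h13 h23,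
    sunflower_outside_sq_sub_prod_eq μ h₁ h₂ h₃ h12 h13 h23]
  ring

/-! ### The two identity families: three mutually independent events -/

variable {E₁ E₂ E₃ : Set Ω}

omit [MeasurableSpace Ω] in
/-- The "star": `U_i = E_j ∩ E_k` has all pairwise intersections equal to `E₁ ∩ E₂ ∩ E₃`. [folklore] -/
theorem star_pairInter (E₁ E₂ E₃ : Set Ω) :
    (E₂ ∩ E₃) ∩ (E₁ ∩ E₃) = E₁ ∩ E₂ ∩ E₃ ∧ (E₂ ∩ E₃) ∩ (E₁ ∩ E₂) = E₁ ∩ E₂ ∩ E₃ ∧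
      (E₁ ∩ E₃) ∩ (E₁ ∩ E₂) = E₁ ∩ E₂ ∩ E₃ := by
  refine ⟨?_, ?_, ?_⟩ <;> ext ω <;> simp only [Set.mem_inter_iff] <;> tauto

omit [MeasurableSpace Ω] in
/-- The "triangle": `U_i = E_i ∪ (E_j ∩ E_k)` has all pairwise intersections equal to
"at least two of `E₁, E₂, E₃`" `= (E₁ ∩ E₂) ∪ (E₁ ∩ E₃) ∪ (E₂ ∩ E₃)`. [folklore] -/
theorem triangle_pairInter (E₁ E₂ E₃ : Set Ω) :
    (E₁ ∪ E₂ ∩ E₃) ∩ (E₂ ∪ E₁ ∩ E₃) = E₁ ∩ E₂ ∪ E₁ ∩ E₃ ∪ E₂ ∩ E₃ ∧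
      (E₁ ∪ E₂ ∩ E₃) ∩ (E₃ ∪ E₁ ∩ E₂) = E₁ ∩ E₂ ∪ E₁ ∩ E₃ ∪ E₂ ∩ E₃ ∧
        (E₂ ∪ E₁ ∩ E₃) ∩ (E₃ ∪ E₁ ∩ E₂) = E₁ ∩ E₂ ∪ E₁ ∩ E₃ ∪ E₂ ∩ E₃ := by
  refine ⟨?_, ?_, ?_⟩ <;> ext ω <;>
    simp only [Set.mem_inter_iff, Set.mem_union] <;> tauto

omit [MeasurableSpace Ω] in
/-- The "triangle": pairwise unions `U_i ∪ U_j = E_i ∪ E_j` and `U₁ ∪ U₂ ∪ U₃ = E₁ ∪ E₂ ∪ E₃`. [folklore] -/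
theorem triangle_pairUnion (E₁ E₂ E₃ : Set Ω) :
    (E₁ ∪ E₂ ∩ E₃) ∪ (E₂ ∪ E₁ ∩ E₃) = E₁ ∪ E₂ ∧ (E₁ ∪ E₂ ∩ E₃) ∪ (E₃ ∪ E₁ ∩ E₂) = E₁ ∪ E₃ ∧
      (E₂ ∪ E₁ ∩ E₃) ∪ (E₃ ∪ E₁ ∩ E₂) = E₂ ∪ E₃ ∧
        (E₁ ∪ E₂ ∩ E₃) ∪ (E₂ ∪ E₁ ∩ E₃) ∪ (E₃ ∪ E₁ ∩ E₂) = E₁ ∪ E₂ ∪ E₃ := by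
  refine ⟨?_, ?_, ?_, ?_⟩ <;> ext ω <;>
    simp only [Set.mem_inter_iff, Set.mem_union] <;> tauto

omit [IsProbabilityMeasure μ] in
/-- **Star identity.**  If `E₁, E₂, E₃` are mutually independent (the four product equalities), then
`μ(E₂∩E₃)·μ(E₁∩E₃)·μ(E₁∩E₂) = μ(E₁∩E₂∩E₃)²`: for the sunflower `U_i = E_j ∩ E_k` (`star_pairInter`) the
core product form of `sunflower_core_sq_sub_prod_eq` vanishes identically.  (E.g. three points of a
finite weighted graph pairwise separated by a hub vertex `h`, with `E_x = {x ↔ h}`.)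
(Not stated in the sources.) [folklore] -/
theorem indep₃_prod_pairInter_eq_sq
    (h12 : μ.real (E₁ ∩ E₂) = μ.real E₁ * μ.real E₂) (h13 : μ.real (E₁ ∩ E₃) = μ.real E₁ * μ.real E₃)
    (h23 : μ.real (E₂ ∩ E₃) = μ.real E₂ * μ.real E₃)
    (h123 : μ.real (E₁ ∩ E₂ ∩ E₃) = μ.real E₁ * μ.real E₂ * μ.real E₃) :
    μ.real (E₂ ∩ E₃) * μ.real (E₁ ∩ E₃) * μ.real (E₁ ∩ E₂) = μ.real (E₁ ∩ E₂ ∩ E₃) ^ 2 := by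
  rw [h12, h13, h23, h123]
  ring

/-- **Triangle identity.**  If `E₁, E₂, E₃` are measurable and mutually independent (the four product
equalities), then `μ((E₁∪E₂)ᶜ)·μ((E₁∪E₃)ᶜ)·μ((E₂∪E₃)ᶜ) = μ((E₁∪E₂∪E₃)ᶜ)²`: for the sunflower
`U_i = E_i ∪ (E_j ∩ E_k)` (`triangle_pairInter`, `triangle_pairUnion`) the outside product form of
`sunflower_outside_sq_sub_prod_eq` vanishes identically.  (E.g. three points of a finite weighted graph
joined only by three internally disjoint two-terminal sub-networks, `E_k = {arc k intact}`.)
(Not stated in the sources.) [folklore] -/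
theorem indep₃_prod_pairUnion_compl_eq_sq (hE₁ : MeasurableSet E₁) (hE₂ : MeasurableSet E₂)
    (hE₃ : MeasurableSet E₃)
    (h12 : μ.real (E₁ ∩ E₂) = μ.real E₁ * μ.real E₂) (h13 : μ.real (E₁ ∩ E₃) = μ.real E₁ * μ.real E₃)
    (h23 : μ.real (E₂ ∩ E₃) = μ.real E₂ * μ.real E₃)
    (h123 : μ.real (E₁ ∩ E₂ ∩ E₃) = μ.real E₁ * μ.real E₂ * μ.real E₃) :
    μ.real (E₁ ∪ E₂)ᶜ * μ.real (E₁ ∪ E₃)ᶜ * μ.real (E₂ ∪ E₃)ᶜ = μ.real (E₁ ∪ E₂ ∪ E₃)ᶜ ^ 2 := by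
  have hU12 : μ.real (E₁ ∪ E₂) = μ.real E₁ + μ.real E₂ - μ.real E₁ * μ.real E₂ := by
    have h := measureReal_union_add_inter (μ := μ) (s := E₁) hE₂
    rw [h12] at h
    linarith
  have hU13 : μ.real (E₁ ∪ E₃) = μ.real E₁ + μ.real E₃ - μ.real E₁ * μ.real E₃ := by
    have h := measureReal_union_add_inter (μ := μ) (s := E₁) hE₃
    rw [h13] at h
    linarith
  have hU23 : μ.real (E₂ ∪ E₃) = μ.real E₂ + μ.real E₃ - μ.real E₂ * μ.real E₃ := by
    have h := measureReal_union_add_inter (μ := μ) (s := E₂) hE₃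
    rw [h23] at h
    linarith
  have hI : μ.real ((E₁ ∪ E₂) ∩ E₃) =
      μ.real E₁ * μ.real E₃ + μ.real E₂ * μ.real E₃ - μ.real E₁ * μ.real E₂ * μ.real E₃ := by
    rw [Set.union_inter_distrib_right]
    have h := measureReal_union_add_inter (μ := μ) (s := E₁ ∩ E₃) (hE₂.inter hE₃)
    have e : E₁ ∩ E₃ ∩ (E₂ ∩ E₃) = E₁ ∩ E₂ ∩ E₃ := by
      ext ω
      simp only [Set.mem_inter_iff]
      tauto
    rw [e, h13, h23, h123] at h
    linarith
  have hU123 : μ.real (E₁ ∪ E₂ ∪ E₃) =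
      μ.real E₁ + μ.real E₂ + μ.real E₃ - μ.real E₁ * μ.real E₂ - μ.real E₁ * μ.real E₃ -
          μ.real E₂ * μ.real E₃ + μ.real E₁ * μ.real E₂ * μ.real E₃ := by
    have h := measureReal_union_add_inter (μ := μ) (s := E₁ ∪ E₂) hE₃
    rw [hI, hU12] at h
    linarith
  rw [probReal_compl_eq_one_sub (hE₁.union hE₂), probReal_compl_eq_one_sub (hE₁.union hE₃),
    probReal_compl_eq_one_sub (hE₂.union hE₃), probReal_compl_eq_one_sub ((hE₁.union hE₂).union hE₃),
    hU12, hU13, hU23, hU123]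
  ring

end General

end Literature.Probability.LatticeModels

/-! ### Bond percolation: Gladkov's bound on the three-point ratio, and the ratio-one identity -/

namespace Literature.Probability.Percolation

open MeasureTheory Literature.Probability.LatticeModels

/-- **Gladkov 2024, Theorem 1.1 (= Theorem 6.2): the `√8` bound on the three-point connectivity
ratio.**  "Let `a, b, c` be distinct vertices of graph `G`. Then `P(abc)² ≤ 8 P(ab)P(ac)P(bc)`, where
`P(abc)` is the probability that `a, b` and `c` are in the same percolation cluster."  Here for Bernoulli
bond percolation `μ = prodBernoulli w` with arbitrary edge weights `w` on a finite vertex type (the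
printed setting "each edge `e ∈ E` is assigned a probability `p_e` of being open"; the printed proof is
for finite `G` first), `{a↔b↔c} = {a↔b} ∩ {a↔c}`.  Proved in print via the decision-tree Harris–Kleitman
and van den Berg–Kesten inequalities; proved in the tree as `gladkov2024_thm_1_1_prodBernoulli`
(`GladkovThreePointBoundWeighted.lean`), whence the discharge `Gladkov2024_threePoint_sq_le_eight_holds` below.
[cite: Gladkov2024, Thm. 1.1 (arXiv p. 2); Thm. 6.2 and §6.2 (arXiv pp. 9–10)] -/
def Gladkov2024_threePoint_sq_le_eight : Prop :=
  ∀ (V : Type) [Finite V] (w : Sym2 V → unitInterval) (a b c : V),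
    a ≠ b → a ≠ c → b ≠ c →
      (prodBernoulli w).real (openConn a b ∩ openConn a c) ^ 2 ≤
        8 * ((prodBernoulli w).real (openConn a b) * (prodBernoulli w).real (openConn a c) *
          (prodBernoulli w).real (openConn b c))

variable {V : Type*} [Finite V]

omit [Finite V] in
/-- `{a↔b} ∩ {b↔c} = {a↔b} ∩ {a↔c}` (transitivity of open connection). [folklore] -/
private theorem openConn_inter_bc_eq' (a b c : V) :
    (openConn a b ∩ openConn b c : Set (BondConfig V)) = openConn a b ∩ openConn a c := by
  ext ω
  constructor
  · rintro ⟨hab, hbc⟩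
    exact ⟨hab, SimpleGraph.Reachable.trans hab hbc⟩
  · rintro ⟨hab, hac⟩
    exact ⟨hab, SimpleGraph.Reachable.trans (SimpleGraph.Reachable.symm hab) hac⟩

omit [Finite V] in
/-- `{a↔c} ∩ {b↔c} = {a↔b} ∩ {a↔c}` (transitivity of open connection). [folklore] -/
private theorem openConn_inter_ac_bc_eq' (a b c : V) :
    (openConn a c ∩ openConn b c : Set (BondConfig V)) = openConn a b ∩ openConn a c := by
  ext ω
  constructor
  · rintro ⟨hac, hbc⟩
    exact ⟨SimpleGraph.Reachable.trans hac (SimpleGraph.Reachable.symm hbc), hac⟩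
  · rintro ⟨hab, hac⟩
    exact ⟨hac, SimpleGraph.Reachable.trans (SimpleGraph.Reachable.symm hab) hac⟩

/-- **Ratio-one identity for three points.**  For `μ = prodBernoulli w` and vertices `a, b, c`, with the
five cells `abc = {a↔b} ∩ {a↔c}`, `a|b|c = {a↔b}ᶜ ∩ {a↔c}ᶜ ∩ {b↔c}ᶜ`, `ab|c = {a↔b} ∩ {a↔c}ᶜ`,
`ac|b = {a↔c} ∩ {a↔b}ᶜ`, `a|bc = {b↔c} ∩ {a↔b}ᶜ` (so `e₂ = Σ` pairwise products and `e₃ =` the product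
of the last three):
`μ(abc)² − μ(a↔b)μ(a↔c)μ(b↔c) = μ(abc)·(μ(a|b|c)μ(abc) − e₂) − e₃`.
So `μ(ab)μ(ac)μ(bc) ≤ μ(abc)²` (three-point ratio `≥ 1`) iff `e₃ ≤ μ(abc)·(μ(a|b|c)μ(abc) − e₂)`, the
cubic companion of the Aas–Gladkov inequality `μ(a|b|c)μ(abc) ≥ e₂` (tree
`prodBernoulli_threePoint_strongHarris`); print has the reverse bound with constant `8`
(`Gladkov2024_threePoint_sq_le_eight`).  (Bookkeeping; not stated in the sources.)
[cite: Gladkov2024, Thm. 1.1 (arXiv p. 2); Gladkov2024StrongFKG, Cor. 4.2] -/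
theorem prodBernoulli_threePoint_sq_sub_prod_eq (w : Sym2 V → unitInterval) (a b c : V) :
    (prodBernoulli w).real (openConn a b ∩ openConn a c) ^ 2 -
        (prodBernoulli w).real (openConn a b) * (prodBernoulli w).real (openConn a c) *
          (prodBernoulli w).real (openConn b c) =
      (prodBernoulli w).real (openConn a b ∩ openConn a c) *
          ((prodBernoulli w).real ((openConn a b)ᶜ ∩ (openConn a c)ᶜ ∩ (openConn b c)ᶜ) *
              (prodBernoulli w).real (openConn a b ∩ openConn a c) -
            ((prodBernoulli w).real (openConn a b ∩ (openConn a c)ᶜ) *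
                (prodBernoulli w).real (openConn a c ∩ (openConn a b)ᶜ) +
              (prodBernoulli w).real (openConn a b ∩ (openConn a c)ᶜ) *
                (prodBernoulli w).real (openConn b c ∩ (openConn a b)ᶜ) +
              (prodBernoulli w).real (openConn a c ∩ (openConn a b)ᶜ) *
                (prodBernoulli w).real (openConn b c ∩ (openConn a b)ᶜ))) -
        (prodBernoulli w).real (openConn a b ∩ (openConn a c)ᶜ) *
          (prodBernoulli w).real (openConn a c ∩ (openConn a b)ᶜ) *
          (prodBernoulli w).real (openConn b c ∩ (openConn a b)ᶜ) := by
  classical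
  set μ := prodBernoulli w with hμ
  set Eab : Set (BondConfig V) := openConn a b with hEab
  set Eac : Set (BondConfig V) := openConn a c with hEac
  set Ebc : Set (BondConfig V) := openConn b c with hEbc
  have mEab : MeasurableSet Eab := MeasurableSet.of_discrete
  have mEac : MeasurableSet Eac := MeasurableSet.of_discrete
  have mEbc : MeasurableSet Ebc := MeasurableSet.of_discrete
  set T : Set (BondConfig V) := Eab ∩ Eac with hT
  have hT₁ : Eab ∩ Ebc = T := openConn_inter_bc_eq' a b c
  have hT₂ : Eac ∩ Ebc = T := openConn_inter_ac_bc_eq' a b c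
  set x := μ.real Eab with hx
  set y := μ.real Eac with hy
  set z := μ.real Ebc with hz
  set t := μ.real T with ht
  have hU : μ.real (Eab ∪ Eac) = x + y - t := by
    have h := measureReal_union_add_inter (μ := μ) (s := Eab) mEac
    linarith
  have hU3 : μ.real (Eab ∪ Eac ∪ Ebc) = x + y + z - 2 * t := by
    have h := measureReal_union_add_inter (μ := μ) (s := Eab ∪ Eac) mEbc
    have hI : (Eab ∪ Eac) ∩ Ebc = T := by
      rw [Set.union_inter_distrib_right, hT₁, hT₂, Set.union_self]
    rw [hI] at h
    linarith
  have cQ : μ.real (Eabᶜ ∩ Eacᶜ ∩ Ebcᶜ) = 1 - x - y - z + 2 * t := by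
    rw [← Set.compl_union, ← Set.compl_union,
      probReal_compl_eq_one_sub ((mEab.union mEac).union mEbc), hU3]
    ring
  have u₃ : μ.real (Eab ∩ Eacᶜ) = x - t := by
    have h := measureReal_inter_add_sdiff (μ := μ) (s := Eab) mEac
    rw [Set.sdiff_eq] at h
    linarith
  have u₂ : μ.real (Eac ∩ Eabᶜ) = y - t := by
    have h := measureReal_inter_add_sdiff (μ := μ) (s := Eac) mEab
    rw [Set.sdiff_eq, Set.inter_comm Eac Eab] at h
    linarith
  have u₁ : μ.real (Ebc ∩ Eabᶜ) = z - t := by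
    have h := measureReal_inter_add_sdiff (μ := μ) (s := Ebc) mEab
    rw [Set.sdiff_eq, Set.inter_comm Ebc Eab, hT₁] at h
    linarith
  rw [cQ, u₃, u₂, u₁]
  ring

/-! ### Discharge of the named fact (appended 2026-08-19, prim-gen-literature gen 14)

`Gladkov2024_threePoint_sq_le_eight` is PROVED in the tree for `prodBernoulli w` on a finite vertex type by
`gladkov2024_thm_1_1_prodBernoulli` (`GladkovThreePointBoundWeighted.lean`: Gladkov's §6.2 proof with the
decision-tree vdBK and Cauchy–Schwarz steps of `DecisionTreeWeighted.lean`); the discharge below transports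
it to the fact's `Finite V` phrasing. -/

/-- **Discharge of `Gladkov2024_threePoint_sq_le_eight`** (Gladkov 2024, Thm. 1.1 = Thm. 6.2 (13)): for
Bernoulli bond percolation with arbitrary edge weights on a finite vertex type and distinct `a, b, c`,
`P(a↔b, a↔c)² ≤ 8·P(a↔b)P(a↔c)P(b↔c)` — from the tree's proof `gladkov2024_thm_1_1_prodBernoulli`.
[cite: Gladkov2024, Thm. 1.1 (arXiv p. 2); Thm. 6.2 and §6.2 (arXiv pp. 9–10)] -/
theorem Gladkov2024_threePoint_sq_le_eight_holds : Gladkov2024_threePoint_sq_le_eight := by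
  intro V _ w a b c hab hac hbc
  cases nonempty_fintype V
  have h := gladkov2024_thm_1_1_prodBernoulli w hab hac hbc
  simpa only [mul_assoc] using h

end Literature.Probability.Percolation
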